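import Mathlib
import Summits.ValiantsHypothesis.ValiantsHypothesis.Theorems.ElementaryWordLengthWordLengthQPStubKappaTwoStructureAux
import Summits.ValiantsHypothesis.ValiantsHypothesis.Theorems.ElementaryWordLengthWordLengthQPStubKappaTwoStructureAuxB
import Summits.ValiantsHypothesis.ValiantsHypothesis.Theorems.ElementaryWordLengthWordLengthQPStubKappaTwoStructureAuxC
import Summits.ValiantsHypothesis.ValiantsHypothesis.Theorems.ElementaryWordLengthWordLengthQPStubKappaTwoStructureAuxD
import Summits.ValiantsHypothesis.ValiantsHypothesis.Theorems.ElementaryWordLengthWordLengthQPStubKappaTwoStructureAuxE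
import Summits.ValiantsHypothesis.ValiantsHypothesis.Theorems.ElementaryWordLengthWordLengthQPStubKappaTwoStructureAuxF

/-!
# Crux `WordLengthQP` (stmt-ValiantsHypothesis-6623), line `positive-monoid-exits` —
helpers for stub `stub_kappaTwoStructure`, part G: CONFINEMENT of the constant letters in the
`(y₁, x₁)` family.

`k2_conf_I`: if the skeleton loop is `P̄₀ E₁₀(a) Q̄ E₀₁(b) P̄₂ = 1` with tame stretches, then no
stretch contains a constant positive `x₂ = E₁₂` or `y₂ = E₂₁` letter: rotating the loop gives
`S (P̄₂P̄₀) S = E₀₁(b) Q̄ʳᵉᵛ E₁₀(a)`, whose untouched adjacent entries `(1,2)`, `(2,1)` are both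
`≥ 0` (from `Q̄ʳᵉᵛ`) and `≤ 0` (from `P̄₂P̄₀ ≥ 0` and the sign flip), hence `0`.
-/

set_option linter.dupNamespace false

noncomputable section

namespace Summit.ValiantsHypothesis.ValiantsHypothesis.Cruxes.WordLengthQP.PositiveMonoidExits

open MvPolynomial

/-- A tame skeleton letter `T` satisfies `T S T = S` over `ℝ`. [folklore] -/
theorem k2r_tame_mul_S_mul {σ : Type} (l : Fin 3 × Fin 3 × ℝ × Option σ) (h : ((0 < Prod.fst (Prod.snd (Prod.snd l)) ∧ (Fin.val (Prod.fst l) + 1 = Fin.val (Prod.fst (Prod.snd l)) ∨ Fin.val (Prod.fst (Prod.snd l)) + 1 = Fin.val (Prod.fst l))) ∨ Prod.fst (Prod.snd (Prod.snd l)) = 0)) :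
    (Matrix.transvection (Prod.fst l) (Prod.fst (Prod.snd l)) (Option.elim (Prod.snd (Prod.snd (Prod.snd l))) (Prod.fst (Prod.snd (Prod.snd l))) (fun _ => (0 : ℝ))) : Matrix (Fin 3) (Fin 3) ℝ) * Matrix.diagonal ![(1 : ℝ), -1, 1] * (Matrix.transvection (Prod.fst l) (Prod.fst (Prod.snd l)) (Option.elim (Prod.snd (Prod.snd (Prod.snd l))) (Prod.fst (Prod.snd (Prod.snd l))) (fun _ => (0 : ℝ))) : Matrix (Fin 3) (Fin 3) ℝ) = Matrix.diagonal ![(1 : ℝ), -1, 1] := by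
  rcases k2_skel_cases l with h1 | ⟨ho, hc, h1⟩
  · rw [h1]; simp
  · rw [h1]
    rcases h with ⟨-, hadj⟩ | h0
    · exact k2_adj_mul_S_mul_adj _ _ hadj _
    · exact absurd h0 hc

/-- Skeleton letters of a tame stretch without constant positive `x₂`, `y₂` letters are `TNB`
(and in particular `BLK`). [folklore] -/
theorem k2_tnb_skel {σ : Type} (l : Fin 3 × Fin 3 × ℝ × Option σ) (h : ((0 < Prod.fst (Prod.snd (Prod.snd l)) ∧ (Fin.val (Prod.fst l) + 1 = Fin.val (Prod.fst (Prod.snd l)) ∨ Fin.val (Prod.fst (Prod.snd l)) + 1 = Fin.val (Prod.fst l))) ∨ Prod.fst (Prod.snd (Prod.snd l)) = 0))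
    (hx2 : l.2.2.2 = none → l.1 = 1 → l.2.1 = 2 → l.2.2.1 = 0)
    (hy2 : l.2.2.2 = none → l.1 = 2 → l.2.1 = 1 → l.2.2.1 = 0) :
    (Matrix.transvection (Prod.fst l) (Prod.fst (Prod.snd l)) (Option.elim (Prod.snd (Prod.snd (Prod.snd l))) (Prod.fst (Prod.snd (Prod.snd l))) (fun _ => (0 : ℝ))) : Matrix (Fin 3) (Fin 3) ℝ) 0 2 = 0 ∧ (Matrix.transvection (Prod.fst l) (Prod.fst (Prod.snd l)) (Option.elim (Prod.snd (Prod.snd (Prod.snd l))) (Prod.fst (Prod.snd (Prod.snd l))) (fun _ => (0 : ℝ))) : Matrix (Fin 3) (Fin 3) ℝ) 1 2 = 0 ∧ (Matrix.transvection (Prod.fst l) (Prod.fst (Prod.snd l)) (Option.elim (Prod.snd (Prod.snd (Prod.snd l))) (Prod.fst (Prod.snd (Prod.snd l))) (fun _ => (0 : ℝ))) : Matrix (Fin 3) (Fin 3) ℝ) 2 0 = 0 ∧ (Matrix.transvection (Prod.fst l) (Prod.fst (Prod.snd l)) (Option.elim (Prod.snd (Prod.snd (Prod.snd l))) (Prod.fst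 (Prod.snd (Prod.snd l))) (fun _ => (0 : ℝ))) : Matrix (Fin 3) (Fin 3) ℝ) 2 1 = 0 ∧ (Matrix.transvection (Prod.fst l) (Prod.fst (Prod.snd l)) (Option.elim (Prod.snd (Prod.snd (Prod.snd l))) (Prod.fst (Prod.snd (Prod.snd l))) (fun _ => (0 : ℝ))) : Matrix (Fin 3) (Fin 3) ℝ) 2 2 = 1 ∧
      0 ≤ (Matrix.transvection (Prod.fst l) (Prod.fst (Prod.snd l)) (Option.elim (Prod.snd (Prod.snd (Prod.snd l))) (Prod.fst (Prod.snd (Prod.snd l))) (fun _ => (0 : ℝ))) : Matrix (Fin 3) (Fin 3) ℝ) 0 1 ∧ 0 ≤ (Matrix.transvection (Prod.fst l) (Prod.fst (Prod.snd l)) (Option.elim (Prod.snd (Prod.snd (Prod.snd l))) (Prod.fst (Prod.snd (Prod.snd l))) (fun _ => (0 : ℝ))) : Matrix (Fin 3) (Fin 3) ℝ) 1 0 ∧ 1 ≤ (Matrix.transvection (Prod.fst l) (Prod.fst (Prod.snd l)) (Option.elim (Prod.snd (Prod.snd (Prod.snd l))) (Prod.fst (Prod.snd (Prod.snd l))) (fun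 _ => (0 : ℝ))) : Matrix (Fin 3) (Fin 3) ℝ) 0 0 ∧ 1 ≤ (Matrix.transvection (Prod.fst l) (Prod.fst (Prod.snd l)) (Option.elim (Prod.snd (Prod.snd (Prod.snd l))) (Prod.fst (Prod.snd (Prod.snd l))) (fun _ => (0 : ℝ))) : Matrix (Fin 3) (Fin 3) ℝ) 1 1 ∧
      (Matrix.transvection (Prod.fst l) (Prod.fst (Prod.snd l)) (Option.elim (Prod.snd (Prod.snd (Prod.snd l))) (Prod.fst (Prod.snd (Prod.snd l))) (fun _ => (0 : ℝ))) : Matrix (Fin 3) (Fin 3) ℝ) 0 0 * (Matrix.transvection (Prod.fst l) (Prod.fst (Prod.snd l)) (Option.elim (Prod.snd (Prod.snd (Prod.snd l))) (Prod.fst (Prod.snd (Prod.snd l))) (fun _ => (0 : ℝ))) : Matrix (Fin 3) (Fin 3) ℝ) 1 1 - (Matrix.transvection (Prod.fst l) (Prod.fst (Prod.snd l)) (Option.elim (Prod.snd (Prod.snd (Prod.snd l))) (Prod.fst (Prod.snd (Prod.snd l))) (fun _ => (0 : ℝ))) : Matrix (Fin 3) (Fin 3) ℝ) 0 1 * (Matrix.transvection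 (Prod.fst l) (Prod.fst (Prod.snd l)) (Option.elim (Prod.snd (Prod.snd (Prod.snd l))) (Prod.fst (Prod.snd (Prod.snd l))) (fun _ => (0 : ℝ))) : Matrix (Fin 3) (Fin 3) ℝ) 1 0 = 1 := by
  rcases k2_skel_cases l with h1 | ⟨ho, hc, h1⟩
  · rw [h1]; exact k2_tnb_letter 0 le_rfl 1 (Or.inl rfl)
  · rcases h with ⟨hpos, hadj⟩ | h0
    · rw [h1]
      rcases k2_adj_types l hadj with ⟨hi, hj⟩ | ⟨hi, hj⟩ | ⟨hi, hj⟩ | ⟨hi, hj⟩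
      · rw [hi, hj]; exact k2_tnb_letter _ hpos.le _ (Or.inr (Or.inl rfl))
      · exact absurd (hx2 ho hi hj) hc
      · rw [hi, hj]; exact k2_tnb_letter _ hpos.le _ (Or.inr (Or.inr rfl))
      · exact absurd (hy2 ho hi hj) hc
    · exact absurd h0 hc

/-- **Confinement, family `(y₁,x₁)`.** See the module docstring. [folklore] -/
theorem k2_conf_I {σ : Type} (p0 q p2 : List (Fin 3 × Fin 3 × ℝ × Option σ)) (a b : ℝ)
    (ht : ∀ l ∈ p0 ++ q ++ p2, ((0 < Prod.fst (Prod.snd (Prod.snd l)) ∧ (Fin.val (Prod.fst l) + 1 = Fin.val (Prod.fst (Prod.snd l)) ∨ Fin.val (Prod.fst (Prod.snd l)) + 1 = Fin.val (Prod.fst l))) ∨ Prod.fst (Prod.snd (Prod.snd l)) = 0))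
    (hloop : (p0.map (fun l => (Matrix.transvection (Prod.fst l) (Prod.fst (Prod.snd l)) (Option.elim (Prod.snd (Prod.snd (Prod.snd l))) (Prod.fst (Prod.snd (Prod.snd l))) (fun _ => (0 : ℝ))) : Matrix (Fin 3) (Fin 3) ℝ))).prod * (Matrix.transvection 1 0 a *
      ((q.map (fun l => (Matrix.transvection (Prod.fst l) (Prod.fst (Prod.snd l)) (Option.elim (Prod.snd (Prod.snd (Prod.snd l))) (Prod.fst (Prod.snd (Prod.snd l))) (fun _ => (0 : ℝ))) : Matrix (Fin 3) (Fin 3) ℝ))).prod * (Matrix.transvection 0 1 b * (p2.map (fun l => (Matrix.transvection (Prod.fst l) (Prod.fst (Prod.snd l)) (Option.elim (Prod.snd (Prod.snd (Prod.snd l))) (Prod.fst (Prod.snd (Prod.snd l))) (fun _ => (0 : ℝ))) : Matrix (Fin 3) (Fin 3) ℝ))).prod))) = 1) :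
    ∀ l ∈ p0 ++ q ++ p2, l.2.2.2 = none →
      (l.1 = 1 → l.2.1 = 2 → l.2.2.1 = 0) ∧ (l.1 = 2 → l.2.1 = 1 → l.2.2.1 = 0) := by
  have hp0 : ∀ l ∈ p0, ((0 < Prod.fst (Prod.snd (Prod.snd l)) ∧ (Fin.val (Prod.fst l) + 1 = Fin.val (Prod.fst (Prod.snd l)) ∨ Fin.val (Prod.fst (Prod.snd l)) + 1 = Fin.val (Prod.fst l))) ∨ Prod.fst (Prod.snd (Prod.snd l)) = 0) := fun l hl => ht l (by simp [hl])
  have hq : ∀ l ∈ q, ((0 < Prod.fst (Prod.snd (Prod.snd l)) ∧ (Fin.val (Prod.fst l) + 1 = Fin.val (Prod.fst (Prod.snd l)) ∨ Fin.val (Prod.fst (Prod.snd l)) + 1 = Fin.val (Prod.fst l))) ∨ Prod.fst (Prod.snd (Prod.snd l)) = 0) := fun l hl => ht l (by simp [hl])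
  have hp2 : ∀ l ∈ p2, ((0 < Prod.fst (Prod.snd (Prod.snd l)) ∧ (Fin.val (Prod.fst l) + 1 = Fin.val (Prod.fst (Prod.snd l)) ∨ Fin.val (Prod.fst (Prod.snd l)) + 1 = Fin.val (Prod.fst l))) ∨ Prod.fst (Prod.snd (Prod.snd l)) = 0) := fun l hl => ht l (by simp [hl])
  set P0 : Matrix (Fin 3) (Fin 3) ℝ := (p0.map (fun l => (Matrix.transvection (Prod.fst l) (Prod.fst (Prod.snd l)) (Option.elim (Prod.snd (Prod.snd (Prod.snd l))) (Prod.fst (Prod.snd (Prod.snd l))) (fun _ => (0 : ℝ))) : Matrix (Fin 3) (Fin 3) ℝ))).prod with hP0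
  set Qm : Matrix (Fin 3) (Fin 3) ℝ := (q.map (fun l => (Matrix.transvection (Prod.fst l) (Prod.fst (Prod.snd l)) (Option.elim (Prod.snd (Prod.snd (Prod.snd l))) (Prod.fst (Prod.snd (Prod.snd l))) (fun _ => (0 : ℝ))) : Matrix (Fin 3) (Fin 3) ℝ))).prod with hQm
  set P2 : Matrix (Fin 3) (Fin 3) ℝ := (p2.map (fun l => (Matrix.transvection (Prod.fst l) (Prod.fst (Prod.snd l)) (Option.elim (Prod.snd (Prod.snd (Prod.snd l))) (Prod.fst (Prod.snd (Prod.snd l))) (fun _ => (0 : ℝ))) : Matrix (Fin 3) (Fin 3) ℝ))).prod with hP2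
  set R : Matrix (Fin 3) (Fin 3) ℝ := (q.map (fun l => (Matrix.transvection (Prod.fst l) (Prod.fst (Prod.snd l)) (Option.elim (Prod.snd (Prod.snd (Prod.snd l))) (Prod.fst (Prod.snd (Prod.snd l))) (fun _ => (0 : ℝ))) : Matrix (Fin 3) (Fin 3) ℝ))).reverse.prod with hR
  set S : Matrix (Fin 3) (Fin 3) ℝ := Matrix.diagonal ![(1 : ℝ), -1, 1] with hSdef
  set X : Matrix (Fin 3) (Fin 3) ℝ := P2 * P0 with hX
  have hSS : S * S = 1 := k2_S_mul_S
  obtain ⟨hq1, hq2⟩ := k2_prod_mul_S_mul_rev S (q.map (fun l => (Matrix.transvection (Prod.fst l) (Prod.fst (Prod.snd l)) (Option.elim (Prod.snd (Prod.snd (Prod.snd l))) (Prod.fst (Prod.snd (Prod.snd l))) (fun _ => (0 : ℝ))) : Matrix (Fin 3) (Fin 3) ℝ))) (fun T hT => by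
    obtain ⟨l, hl, rfl⟩ := List.mem_map.1 hT
    exact k2r_tame_mul_S_mul l (hq l hl))
  -- rotate the loop
  have h1 : Matrix.transvection 1 0 a * (Qm * (Matrix.transvection 0 1 b * P2)) * P0 = 1 :=
    mul_eq_one_comm.mp hloop
  have h2 : Matrix.transvection 1 0 a * (Qm * (Matrix.transvection 0 1 b * X)) = 1 := by
    rw [hX]; simpa only [Matrix.mul_assoc] using h1
  have h3 : Qm * (Matrix.transvection 0 1 b * X) = Matrix.transvection 1 0 (-a) :=
    (k2_skel_inv_letter 1 0 (by decide) a _).1 h2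
  have hinv : S * R * S * Qm = 1 := by
    calc S * R * S * Qm = S * (R * S * Qm) := by simp only [Matrix.mul_assoc]
      _ = 1 := by rw [hq2, hSS]
  have h4 : Matrix.transvection 0 1 b * X = S * R * S * Matrix.transvection 1 0 (-a) := by
    have := congrArg (fun Y => S * R * S * Y) h3
    simpa only [← Matrix.mul_assoc, hinv, Matrix.one_mul] using this
  have h5 : X = Matrix.transvection 0 1 (-b) * (S * R * S * Matrix.transvection 1 0 (-a)) := by
    rw [← h4, ← Matrix.mul_assoc, Matrix.transvection_mul_transvection_same _ _ (by decide)]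
    simp
  have h6 : S * X * S = Matrix.transvection 0 1 b * R * Matrix.transvection 1 0 a := by
    rw [h5]
    calc S * (Matrix.transvection 0 1 (-b) * (S * R * S * Matrix.transvection 1 0 (-a))) * S
        = (S * Matrix.transvection 0 1 (-b) * S) * R * (S * Matrix.transvection 1 0 (-a) * S) := by
          simp only [Matrix.mul_assoc]
      _ = Matrix.transvection 0 1 b * R * Matrix.transvection 1 0 a := by
          rw [hSdef, k2_S_T_S, k2_S_T_S]; simp
  -- X ≥ 0 off the diagonal
  have hXnn : ∀ i j, 0 ≤ (X - 1) i j := by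
    have : X = ((p2 ++ p0).map (fun l => (Matrix.transvection (Prod.fst l) (Prod.fst (Prod.snd l)) (Option.elim (Prod.snd (Prod.snd (Prod.snd l))) (Prod.fst (Prod.snd (Prod.snd l))) (fun _ => (0 : ℝ))) : Matrix (Fin 3) (Fin 3) ℝ))).prod := by
      rw [hX, List.map_append, List.prod_append]
    rw [this]
    refine k2r_prod_sub_one_nonneg _ fun T hT => ?_
    obtain ⟨l, hl, rfl⟩ := List.mem_map.1 hT
    exact k2r_tame_sub_one_nonneg l (by
      rcases List.mem_append.1 hl with h | h
      · exact hp2 l h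
      · exact hp0 l h)
  have hX12 : 0 ≤ X 1 2 := by simpa [Matrix.one_apply] using hXnn 1 2
  have hX21 : 0 ≤ X 2 1 := by simpa [Matrix.one_apply] using hXnn 2 1
  -- the untouched entries of S X S
  have e12 : (S * X * S) 1 2 = R 1 2 := by
    rw [h6, Matrix.mul_transvection_apply_of_ne _ _ _ _ (by decide),
      Matrix.transvection_mul_apply_of_ne _ _ _ _ (by decide)]
  have e21 : (S * X * S) 2 1 = R 2 1 := by
    rw [h6, Matrix.mul_transvection_apply_of_ne _ _ _ _ (by decide),
      Matrix.transvection_mul_apply_of_ne _ _ _ _ (by decide)]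
  have s12 : (S * X * S) 1 2 = -X 1 2 := by rw [hSdef, k2_SXS_apply]; simp
  have s21 : (S * X * S) 2 1 = -X 2 1 := by rw [hSdef, k2_SXS_apply]; simp
  have hR12 : R 1 2 ≤ 0 := by linarith
  have hR21 : R 2 1 ≤ 0 := by linarith
  -- no constant positive x₂ / y₂ in q
  have hRrev : R = (q.reverse.map (fun l => (Matrix.transvection (Prod.fst l) (Prod.fst (Prod.snd l)) (Option.elim (Prod.snd (Prod.snd (Prod.snd l))) (Prod.fst (Prod.snd (Prod.snd l))) (fun _ => (0 : ℝ))) : Matrix (Fin 3) (Fin 3) ℝ))).prod := by rw [hR, List.map_reverse]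
  have hqrev : ∀ l ∈ q.reverse, ((0 < Prod.fst (Prod.snd (Prod.snd l)) ∧ (Fin.val (Prod.fst l) + 1 = Fin.val (Prod.fst (Prod.snd l)) ∨ Fin.val (Prod.fst (Prod.snd l)) + 1 = Fin.val (Prod.fst l))) ∨ Prod.fst (Prod.snd (Prod.snd l)) = 0) := fun l hl => hq l (List.mem_reverse.1 hl)
  have qx2 := k2r_no_const_letter q.reverse hqrev 1 2 (by decide) (by rw [← hRrev]; exact hR12)
  have qy2 := k2r_no_const_letter q.reverse hqrev 2 1 (by decide) (by rw [← hRrev]; exact hR21)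
  -- hence R is BLK, so is S X S, so X₁₂ = X₂₁ = 0
  have hRblk : R 0 2 = 0 ∧ R 1 2 = 0 ∧ R 2 0 = 0 ∧ R 2 1 = 0 ∧ R 2 2 = 1 := by
    rw [hR]
    refine k2_blk_prod _ fun G hG => ?_
    rw [List.mem_reverse] at hG
    obtain ⟨l, hl, rfl⟩ := List.mem_map.1 hG
    have t := k2_tnb_skel l (hq l hl) (fun ho hi hj => qx2 l (List.mem_reverse.2 hl) ho hi hj)
      (fun ho hi hj => qy2 l (List.mem_reverse.2 hl) ho hi hj)
    exact ⟨t.1, t.2.1, t.2.2.1, t.2.2.2.1, t.2.2.2.2.1⟩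
  have hSXS := k2_blk_mul _ _ (k2_blk_mul _ _ (k2_blk_letter b).1 hRblk) (k2_blk_letter a).2
  rw [← h6] at hSXS
  have x12 : X 1 2 = 0 := by linarith [hSXS.2.1]
  have x21 : X 2 1 = 0 := by linarith [hSXS.2.2.2.1]
  -- no constant positive x₂ / y₂ in p2 ++ p0
  have hX' : X = ((p2 ++ p0).map (fun l => (Matrix.transvection (Prod.fst l) (Prod.fst (Prod.snd l)) (Option.elim (Prod.snd (Prod.snd (Prod.snd l))) (Prod.fst (Prod.snd (Prod.snd l))) (fun _ => (0 : ℝ))) : Matrix (Fin 3) (Fin 3) ℝ))).prod := by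
    rw [hX, List.map_append, List.prod_append]
  have ht20 : ∀ l ∈ p2 ++ p0, ((0 < Prod.fst (Prod.snd (Prod.snd l)) ∧ (Fin.val (Prod.fst l) + 1 = Fin.val (Prod.fst (Prod.snd l)) ∨ Fin.val (Prod.fst (Prod.snd l)) + 1 = Fin.val (Prod.fst l))) ∨ Prod.fst (Prod.snd (Prod.snd l)) = 0) := fun l hl => by
    rcases List.mem_append.1 hl with h | h
    · exact hp2 l h
    · exact hp0 l h
  have px2 := k2r_no_const_letter (p2 ++ p0) ht20 1 2 (by decide) (by rw [← hX']; exact x12.le)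
  have py2 := k2r_no_const_letter (p2 ++ p0) ht20 2 1 (by decide) (by rw [← hX']; exact x21.le)
  -- assemble
  intro l hl ho
  simp only [List.mem_append] at hl
  rcases hl with (h | h) | h
  · exact ⟨px2 l (by simp [h]) ho, py2 l (by simp [h]) ho⟩
  · exact ⟨qx2 l (List.mem_reverse.2 h) ho, qy2 l (List.mem_reverse.2 h) ho⟩
  · exact ⟨px2 l (by simp [h]) ho, py2 l (by simp [h]) ho⟩

end Summit.ValiantsHypothesis.ValiantsHypothesis.Cruxes.WordLengthQP.PositiveMonoidExits

end
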